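import Literature.Topology.PlanarFoliations.BiOrient
import Literature.Topology.FourManifolds.TautFoliationsLeafPaths
import Mathlib.Topology.Order.IntermediateValue
import HarnessLib

/-!
# The chart sign of an injective leafwise path is constant along the path

Topic: Topology / PlanarFoliations, sequel to `BiOrient.lean` (bi-oriented foliations: any two
flow boxes agree tangentially, `TangentSame`) and `TautFoliationsLeafPaths.lean` (leafwise
continuous maps stay in plaques). Let `c : ℝ → X` be continuous into the leaf space and injective
on an open interval `S`. Read in a flow box `e` of the atlas around `c t`, the leaf coordinate
`u ↦ (e (c u)).1` is, near `t`, strictly increasing or strictly decreasing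
(`exists_strictMonoOn_or_strictAntiOn`: it is continuous and injective on a small interval, the
path staying in one plaque). For a **bi-oriented** foliation this **chart sign does not depend
on the box** (`strictMonoOn_transfer`) and **is constant along the path**
(`forall_strictMonoOn_or_forall_strictAntiOn`): the increasing and the decreasing parameter sets
are open and disjoint and cover the connected `S`. Used to orient the compact leaves traced
around a separatrix graph coherently with the separatrices they hug.

All statements are [folklore].
-/

noncomputable section

open Set Filter Function
open _root_.Topology
open Literature.Topology.FourManifolds Literature.Topology.FourManifolds.Foliation

namespace Literature.Topology.PlanarFoliations

variable {X : Type*} [TopologicalSpace X] {F : Foliation ℝ X} {c : ℝ → X} {S : Set ℝ}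

/-- **Near each parameter the leaf coordinate of an injective leafwise path in a flow box is
strictly monotone**, of one of the two types; the path stays in the source, in one plaque.
[folklore] -/
theorem exists_strictMonoOn_or_strictAntiOn (hc : Continuous (toLeafSpace ∘ c : ℝ → F.LeafSpace)) (hS : IsOpen S)
    (hinj : InjOn c S) {e : OpenPartialHomeomorph X (ℝ × ℝ)} (he : e ∈ F.atlas) {t : ℝ} (ht : t ∈ S) (hte : c t ∈ e.source) :
    ∃ δ > (0 : ℝ), Icc (t - δ) (t + δ) ⊆ S ∧ (∀ u ∈ Icc (t - δ) (t + δ), c u ∈ e.source ∧ (e (c u)).2 = (e (c t)).2) ∧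
      (StrictMonoOn (fun u ↦ (e (c u)).1) (Icc (t - δ) (t + δ)) ∨ StrictAntiOn (fun u ↦ (e (c u)).1) (Icc (t - δ) (t + δ))) := by
  -- a small interval in `S` on which the path stays in the plaque of `c t`
  have hpl := F.eventually_mem_plaque_of_continuousAt hc.continuousAt he hte
  obtain ⟨ε₁, hε₁, hball₁⟩ := Metric.eventually_nhds_iff.1 hpl
  obtain ⟨ε₂, hε₂, hball₂⟩ := Metric.isOpen_iff.1 hS t ht
  set δ := min ε₁ ε₂ / 2 with hδ
  have hδpos : 0 < δ := by rw [hδ]; exact half_pos (lt_min hε₁ hε₂)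
  have hIcc : ∀ u ∈ Icc (t - δ) (t + δ), dist u t < min ε₁ ε₂ := fun u hu ↦ by
    rw [Real.dist_eq, abs_lt]; constructor <;> linarith [hu.1, hu.2, min_le_left ε₁ ε₂, min_le_right ε₁ ε₂]
  have hsub : Icc (t - δ) (t + δ) ⊆ S := fun u hu ↦ hball₂ (Metric.mem_ball.2 ((hIcc u hu).trans_le (min_le_right _ _)))
  have hplaque : ∀ u ∈ Icc (t - δ) (t + δ), c u ∈ plaque e (e (c t)).2 := fun u hu ↦ hball₁ ((hIcc u hu).trans_le (min_le_left _ _))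
  refine ⟨δ, hδpos, hsub, fun u hu ↦ ⟨(hplaque u hu).1, (hplaque u hu).2⟩, ?_⟩
  -- continuous and injective on the interval: strictly monotone
  have hcM : Continuous c := F.continuous_of_continuous_toLeafSpace hc
  have hcont : ContinuousOn (fun u ↦ (e (c u)).1) (Icc (t - δ) (t + δ)) :=
    continuous_fst.comp_continuousOn (e.continuousOn.comp hcM.continuousOn fun u hu ↦ (hplaque u hu).1)
  have hinj' : InjOn (fun u ↦ (e (c u)).1) (Icc (t - δ) (t + δ)) := by
    intro u hu u' hu' huu'
    have heq : e (c u) = e (c u') := Prod.ext huu' ((hplaque u hu).2.trans (hplaque u' hu').2.symm)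
    exact hinj (hsub hu) (hsub hu') (e.injOn (hplaque u hu).1 (hplaque u' hu').1 heq)
  exact ContinuousOn.strictMonoOn_of_injOn_Icc' (by linarith) hcont hinj'

/-- **The chart sign does not depend on the box** (bi-oriented foliations): increasing in `e`
near `t` forces increasing in `e'` near `t`. [folklore] -/
theorem strictMonoOn_transfer (hbi : IsBiOriented F) (hc : Continuous (toLeafSpace ∘ c : ℝ → F.LeafSpace)) (hS : IsOpen S)
    (hinj : InjOn c S) {e e' : OpenPartialHomeomorph X (ℝ × ℝ)} (he : e ∈ F.atlas) (he' : e' ∈ F.atlas) {t : ℝ} (ht : t ∈ S)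
    (hte : c t ∈ e.source) (hte' : c t ∈ e'.source) {δ : ℝ} (hδ : 0 < δ)
    (hmono : StrictMonoOn (fun u ↦ (e (c u)).1) (Icc (t - δ) (t + δ))) :
    ∃ δ' > (0 : ℝ), StrictMonoOn (fun u ↦ (e' (c u)).1) (Icc (t - δ') (t + δ')) := by
  obtain ⟨U, hU, hsame⟩ := hbi e he e' he' (c t) ⟨hte, hte'⟩
  -- a small interval mapped into `U`, into both sources and one plaque of `e`
  obtain ⟨δ₁, hδ₁, -, hpl₁, -⟩ := exists_strictMonoOn_or_strictAntiOn hc hS hinj he ht hte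
  obtain ⟨δ₂, hδ₂, -, hpl₂, -⟩ := exists_strictMonoOn_or_strictAntiOn hc hS hinj he' ht hte'
  have hcM : Continuous c := F.continuous_of_continuous_toLeafSpace hc
  obtain ⟨δ₃, hδ₃, hball₃⟩ := Metric.eventually_nhds_iff.1 (hcM.continuousAt.preimage_mem_nhds hU)
  set δ' := min (min δ δ₁) (min δ₂ (δ₃ / 2)) with hδ'
  have hδ'pos : 0 < δ' := lt_min (lt_min hδ hδ₁) (lt_min hδ₂ (half_pos hδ₃))
  have hI : ∀ {r}, δ' ≤ r → Icc (t - δ') (t + δ') ⊆ Icc (t - r) (t + r) := fun h ↦ Icc_subset_Icc (by linarith) (by linarith)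
  have hIδ := hI (show δ' ≤ δ from (min_le_left _ _).trans (min_le_left _ _))
  have hIδ₁ := hI (show δ' ≤ δ₁ from (min_le_left _ _).trans (min_le_right _ _))
  have hIδ₂ := hI (show δ' ≤ δ₂ from (min_le_right _ _).trans (min_le_left _ _))
  have hU' : ∀ u ∈ Icc (t - δ') (t + δ'), c u ∈ U := fun u hu ↦ hball₃ (by
    rw [Real.dist_eq, abs_lt]
    have : δ' ≤ δ₃ / 2 := (min_le_right _ _).trans (min_le_right _ _)
    constructor <;> linarith [hu.1, hu.2])
  refine ⟨δ', hδ'pos, fun u hu u' hu' huu' ↦ ?_⟩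
  have hmem : ∀ {w}, w ∈ Icc (t - δ') (t + δ') → c w ∈ U ∩ (e.source ∩ e'.source) := fun {w} hw ↦
    ⟨hU' w hw, (hpl₁ w (hIδ₁ hw)).1, (hpl₂ w (hIδ₂ hw)).1⟩
  have hheight : (e (c u)).2 = (e (c u')).2 := (hpl₁ u (hIδ₁ hu)).2.trans (hpl₁ u' (hIδ₁ hu')).2.symm
  exact hsame _ (hmem hu) _ (hmem hu') hheight (hmono (hIδ hu) (hIδ hu') huu')

/-- The chart sign does not depend on the box: decreasing in `e` forces decreasing in `e'`.
[folklore] -/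
theorem strictAntiOn_transfer (hbi : IsBiOriented F) (hc : Continuous (toLeafSpace ∘ c : ℝ → F.LeafSpace)) (hS : IsOpen S)
    (hinj : InjOn c S) {e e' : OpenPartialHomeomorph X (ℝ × ℝ)} (he : e ∈ F.atlas) (he' : e' ∈ F.atlas) {t : ℝ} (ht : t ∈ S)
    (hte : c t ∈ e.source) (hte' : c t ∈ e'.source) {δ : ℝ} (hδ : 0 < δ)
    (hanti : StrictAntiOn (fun u ↦ (e (c u)).1) (Icc (t - δ) (t + δ))) :
    ∃ δ' > (0 : ℝ), StrictAntiOn (fun u ↦ (e' (c u)).1) (Icc (t - δ') (t + δ')) := by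
  obtain ⟨U, hU, hsame⟩ := hbi e he e' he' (c t) ⟨hte, hte'⟩
  obtain ⟨δ₁, hδ₁, -, hpl₁, -⟩ := exists_strictMonoOn_or_strictAntiOn hc hS hinj he ht hte
  obtain ⟨δ₂, hδ₂, -, hpl₂, -⟩ := exists_strictMonoOn_or_strictAntiOn hc hS hinj he' ht hte'
  have hcM : Continuous c := F.continuous_of_continuous_toLeafSpace hc
  obtain ⟨δ₃, hδ₃, hball₃⟩ := Metric.eventually_nhds_iff.1 (hcM.continuousAt.preimage_mem_nhds hU)
  set δ' := min (min δ δ₁) (min δ₂ (δ₃ / 2)) with hδ'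
  have hδ'pos : 0 < δ' := lt_min (lt_min hδ hδ₁) (lt_min hδ₂ (half_pos hδ₃))
  have hI : ∀ {r}, δ' ≤ r → Icc (t - δ') (t + δ') ⊆ Icc (t - r) (t + r) := fun h ↦ Icc_subset_Icc (by linarith) (by linarith)
  have hIδ := hI (show δ' ≤ δ from (min_le_left _ _).trans (min_le_left _ _))
  have hIδ₁ := hI (show δ' ≤ δ₁ from (min_le_left _ _).trans (min_le_right _ _))
  have hIδ₂ := hI (show δ' ≤ δ₂ from (min_le_right _ _).trans (min_le_left _ _))
  have hU' : ∀ u ∈ Icc (t - δ') (t + δ'), c u ∈ U := fun u hu ↦ hball₃ (by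
    rw [Real.dist_eq, abs_lt]
    have : δ' ≤ δ₃ / 2 := (min_le_right _ _).trans (min_le_right _ _)
    constructor <;> linarith [hu.1, hu.2])
  refine ⟨δ', hδ'pos, fun u hu u' hu' huu' ↦ ?_⟩
  have hmem : ∀ {w}, w ∈ Icc (t - δ') (t + δ') → c w ∈ U ∩ (e.source ∩ e'.source) := fun {w} hw ↦
    ⟨hU' w hw, (hpl₁ w (hIδ₁ hw)).1, (hpl₂ w (hIδ₂ hw)).1⟩
  have hheight : (e (c u')).2 = (e (c u)).2 := (hpl₁ u' (hIδ₁ hu')).2.trans (hpl₁ u (hIδ₁ hu)).2.symm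
  exact hsame _ (hmem hu') _ (hmem hu) hheight (hanti (hIδ hu) (hIδ hu') huu')

/-- A function is not both strictly increasing and strictly decreasing on a nontrivial interval.
[folklore] -/
theorem not_strictMonoOn_and_strictAntiOn {f : ℝ → ℝ} {t δ δ' : ℝ} (hδ : 0 < δ) (hδ' : 0 < δ')
    (h₁ : StrictMonoOn f (Icc (t - δ) (t + δ))) (h₂ : StrictAntiOn f (Icc (t - δ') (t + δ'))) : False := by
  set r := min δ δ' with hr
  have hrpos : 0 < r := lt_min hδ hδ'
  have ht₁ : t ∈ Icc (t - δ) (t + δ) := ⟨by linarith, by linarith⟩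
  have ht₂ : t ∈ Icc (t - δ') (t + δ') := ⟨by linarith, by linarith⟩
  have hs₁ : t + r ∈ Icc (t - δ) (t + δ) := ⟨by linarith, by linarith [min_le_left δ δ']⟩
  have hs₂ : t + r ∈ Icc (t - δ') (t + δ') := ⟨by linarith, by linarith [min_le_right δ δ']⟩
  have hlt : t < t + r := by linarith
  exact lt_asymm (h₁ ht₁ hs₁ hlt) (h₂ ht₂ hs₂ hlt)

/-- **The chart sign of an injective leafwise path on an open interval is constant** (bi-oriented
foliations): in every box of the atlas around every point of the path, the leaf coordinate is
locally strictly increasing along the path — or, in every box around every point, locally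
strictly decreasing. [folklore] -/
theorem forall_strictMonoOn_or_forall_strictAntiOn (hbi : IsBiOriented F) (hc : Continuous (toLeafSpace ∘ c : ℝ → F.LeafSpace))
    {a b : ℝ} (hinj : InjOn c (Ioo a b)) :
    (∀ t ∈ Ioo a b, ∀ e ∈ F.atlas, c t ∈ e.source → ∃ δ > (0 : ℝ), StrictMonoOn (fun u ↦ (e (c u)).1) (Icc (t - δ) (t + δ))) ∨
    (∀ t ∈ Ioo a b, ∀ e ∈ F.atlas, c t ∈ e.source → ∃ δ > (0 : ℝ), StrictAntiOn (fun u ↦ (e (c u)).1) (Icc (t - δ) (t + δ))) := by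
  set S := Ioo a b with hSdef
  have hS : IsOpen S := isOpen_Ioo
  -- the increasing and the decreasing parameter sets
  set A : Set ℝ := {t ∈ S | ∃ e ∈ F.atlas, c t ∈ e.source ∧ ∃ δ > (0 : ℝ), StrictMonoOn (fun u ↦ (e (c u)).1) (Icc (t - δ) (t + δ))}
    with hA
  set Bs : Set ℝ := {t ∈ S | ∃ e ∈ F.atlas, c t ∈ e.source ∧ ∃ δ > (0 : ℝ), StrictAntiOn (fun u ↦ (e (c u)).1) (Icc (t - δ) (t + δ))}
    with hB
  -- both are open
  have hAo : IsOpen A := by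
    refine Metric.isOpen_iff.2 fun t ⟨htS, e, he, hte, δ, hδ, hmono⟩ ↦ ?_
    obtain ⟨δ₁, hδ₁, hsub, hpl, -⟩ := exists_strictMonoOn_or_strictAntiOn hc hS hinj he htS hte
    refine ⟨min δ δ₁ / 2, half_pos (lt_min hδ hδ₁), fun t' ht' ↦ ?_⟩
    rw [Metric.mem_ball, Real.dist_eq, abs_lt] at ht'
    have h1 : min δ δ₁ ≤ δ := min_le_left _ _
    have h2 : min δ δ₁ ≤ δ₁ := min_le_right _ _
    have ht'I : t' ∈ Icc (t - δ₁) (t + δ₁) := ⟨by linarith [ht'.1], by linarith [ht'.2]⟩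
    refine ⟨hsub ht'I, e, he, (hpl t' ht'I).1, min δ δ₁ / 2, half_pos (lt_min hδ hδ₁), hmono.mono (Icc_subset_Icc ?_ ?_)⟩
    · linarith [ht'.1]
    · linarith [ht'.2]
  have hBo : IsOpen Bs := by
    refine Metric.isOpen_iff.2 fun t ⟨htS, e, he, hte, δ, hδ, hanti⟩ ↦ ?_
    obtain ⟨δ₁, hδ₁, hsub, hpl, -⟩ := exists_strictMonoOn_or_strictAntiOn hc hS hinj he htS hte
    refine ⟨min δ δ₁ / 2, half_pos (lt_min hδ hδ₁), fun t' ht' ↦ ?_⟩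
    rw [Metric.mem_ball, Real.dist_eq, abs_lt] at ht'
    have h1 : min δ δ₁ ≤ δ := min_le_left _ _
    have h2 : min δ δ₁ ≤ δ₁ := min_le_right _ _
    have ht'I : t' ∈ Icc (t - δ₁) (t + δ₁) := ⟨by linarith [ht'.1], by linarith [ht'.2]⟩
    refine ⟨hsub ht'I, e, he, (hpl t' ht'I).1, min δ δ₁ / 2, half_pos (lt_min hδ hδ₁), hanti.mono (Icc_subset_Icc ?_ ?_)⟩
    · linarith [ht'.1]
    · linarith [ht'.2]
  -- they cover `S`
  have hcover : S ⊆ A ∪ Bs := by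
    intro t htS
    obtain ⟨e, he, hte⟩ := F.exists_mem_source (c t)
    obtain ⟨δ, hδ, -, -, hm | ha⟩ := exists_strictMonoOn_or_strictAntiOn hc hS hinj he htS hte
    · exact Or.inl ⟨htS, e, he, hte, δ, hδ, hm⟩
    · exact Or.inr ⟨htS, e, he, hte, δ, hδ, ha⟩
  -- and are disjoint (the sign does not depend on the box)
  have hdisj : Disjoint A Bs := by
    rw [disjoint_left]
    rintro t ⟨htS, e, he, hte, δ, hδ, hm⟩ ⟨-, e', he', hte', δ', hδ', ha⟩
    obtain ⟨δ'', hδ'', hm'⟩ := strictMonoOn_transfer hbi hc hS hinj he he' htS hte hte' hδ hm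
    exact not_strictMonoOn_and_strictAntiOn hδ'' hδ' hm' ha
  -- `S` is connected
  rcases isPreconnected_Ioo.subset_or_subset hAo hBo hdisj hcover with h | h
  · left
    intro t htS e he hte
    obtain ⟨-, e₀, he₀, hte₀, δ₀, hδ₀, hm₀⟩ := h htS
    exact strictMonoOn_transfer hbi hc hS hinj he₀ he htS hte₀ hte hδ₀ hm₀
  · right
    intro t htS e he hte
    obtain ⟨-, e₀, he₀, hte₀, δ₀, hδ₀, ha₀⟩ := h htS
    exact strictAntiOn_transfer hbi hc hS hinj he₀ he htS hte₀ hte hδ₀ ha₀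

end Literature.Topology.PlanarFoliations
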